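import Summits.MatrixMultiplication.MatrixMultiplication.Theorems.OutsiderSandwichToricCeilingPowThreeCwBaseCensus3A

/-!
# OutsiderSandwich — toric ceiling of `cw₂^{⊠N}`: the `N = 3` three-cw base, PAIR census 3B
(group `cZ3`, part B of 2: 272 of 632 instances; decomp-mm lens 4, gen 47, kernel K47-9 census;
THESES-FREE, `ω`-free; helper toward `LaserTangency`, stmt-32268)

LABEL.  TORIC · FINITE (`N = 3`) · NEC-side instrument.  In CHUNKS of at most 60 instances (kernel
memory / time ceiling on the gate): the certificate pair `datc3[i]` satisfies `goodP₁` for the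
instance `(instOf₁ cZ3)[i]` — both decode to `valid₁` perfect matchings of `cw ⊠ cw ⊠ cw` minus the
instance and the second misses a row of the first (`census₃_3_r`, `decide +kernel`, standard axioms;
no `native_decide`, no `ofReduceBool`); `cover₃_3` collects all chunks of the group.  Consumed by
`…ThreeCwBase`.
WHAT THIS IS NOT: no statement about tensors or `ω`.
-/

set_option linter.dupNamespace false
set_option maxRecDepth 200000
set_option Elab.async false

namespace Summit.MatrixMultiplication.MatrixMultiplication.Theorems.OutsiderSandwichToricCeilingPowThreeCwBaseCensus3B

open Summit.MatrixMultiplication.MatrixMultiplication.Theorems.OutsiderSandwichToricCeilingPowTwoCwBaseDefs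
open Summit.MatrixMultiplication.MatrixMultiplication.Theorems.OutsiderSandwichToricCeilingPowThreeCwBaseDefs
open Summit.MatrixMultiplication.MatrixMultiplication.Theorems.OutsiderSandwichToricCeilingPowThreeCwBaseData3
open Summit.MatrixMultiplication.MatrixMultiplication.Theorems.OutsiderSandwichToricCeilingPowThreeCwBaseCensus3A

set_option maxHeartbeats 0 in
/-- PAIR CENSUS, group `cZ3`, instances `360 … 419` (kernel-decided). -/
theorem census₃_3_6 : ((((instOf₁ cZ3).zip datc3).drop 360).take 60).all
    (fun p => goodP₁ p.1 p.2.1 p.2.2) = true := by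
  decide +kernel

set_option maxHeartbeats 0 in
/-- PAIR CENSUS, group `cZ3`, instances `420 … 479` (kernel-decided). -/
theorem census₃_3_7 : ((((instOf₁ cZ3).zip datc3).drop 420).take 60).all
    (fun p => goodP₁ p.1 p.2.1 p.2.2) = true := by
  decide +kernel

set_option maxHeartbeats 0 in
/-- PAIR CENSUS, group `cZ3`, instances `480 … 539` (kernel-decided). -/
theorem census₃_3_8 : ((((instOf₁ cZ3).zip datc3).drop 480).take 60).all
    (fun p => goodP₁ p.1 p.2.1 p.2.2) = true := by
  decide +kernel

set_option maxHeartbeats 0 in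
/-- PAIR CENSUS, group `cZ3`, instances `540 … 599` (kernel-decided). -/
theorem census₃_3_9 : ((((instOf₁ cZ3).zip datc3).drop 540).take 60).all
    (fun p => goodP₁ p.1 p.2.1 p.2.2) = true := by
  decide +kernel

set_option maxHeartbeats 0 in
/-- PAIR CENSUS, group `cZ3`, instances `600 … 631` (kernel-decided). -/
theorem census₃_3_10 : ((((instOf₁ cZ3).zip datc3).drop 600).take 32).all
    (fun p => goodP₁ p.1 p.2.1 p.2.2) = true := by
  decide +kernel

/-- Group `cZ3`: every index is covered by a decided chunk (chunks of this file and of the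
earlier parts of the group). -/
theorem cover₃_3 : ∀ i < datc3.length, ∃ lo n, lo ≤ i ∧ i < lo + n ∧
    ((((instOf₁ cZ3).zip datc3).drop lo).take n).all (fun p => goodP₁ p.1 p.2.1 p.2.2) = true := by
  intro i hi
  rw [dlenc3] at hi
  by_cases h0 : i < 60
  · exact ⟨0, 60, by omega, by omega, census₃_3_0⟩
  by_cases h1 : i < 120
  · exact ⟨60, 60, by omega, by omega, census₃_3_1⟩
  by_cases h2 : i < 180
  · exact ⟨120, 60, by omega, by omega, census₃_3_2⟩
  by_cases h3 : i < 240
  · exact ⟨180, 60, by omega, by omega, census₃_3_3⟩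
  by_cases h4 : i < 300
  · exact ⟨240, 60, by omega, by omega, census₃_3_4⟩
  by_cases h5 : i < 360
  · exact ⟨300, 60, by omega, by omega, census₃_3_5⟩
  by_cases h6 : i < 420
  · exact ⟨360, 60, by omega, by omega, census₃_3_6⟩
  by_cases h7 : i < 480
  · exact ⟨420, 60, by omega, by omega, census₃_3_7⟩
  by_cases h8 : i < 540
  · exact ⟨480, 60, by omega, by omega, census₃_3_8⟩
  by_cases h9 : i < 600
  · exact ⟨540, 60, by omega, by omega, census₃_3_9⟩
  · exact ⟨600, 32, by omega, by omega, census₃_3_10⟩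

end Summit.MatrixMultiplication.MatrixMultiplication.Theorems.OutsiderSandwichToricCeilingPowThreeCwBaseCensus3B
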